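import Literature.Combinatorics.Optimization.CorrelationPolytopeMinorMonotone
import HarnessLib

/-!
# Faces of correlation polytopes cut out by valid inequalities, and their linear images
# (the "face which projects to `COR(K)`" toolkit of Aboulker–Fiorini–Huynh–Macchia–Seif 2019, §2)

[topic Combinatorics/Optimization]

P. Aboulker, S. Fiorini, T. Huynh, M. Macchia, J. Seif, *Extension complexity of the correlation
polytope*, Oper. Res. Lett. 47 (2019) 47–51 = arXiv:1806.00541 [AboulkerEtAl2019] (held text
`paper:arxiv-1806.00541`; `pNNNN Lk` = chunk/line of the lit-read materialisation) prove their lower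
bound (Theorem 6) by describing "a face of `COR(H)` which projects to the correlation polytope of the
complete bipartite graph `K_{h,h}`" (p0005 L53), the face being cut out by equations that
"originate from valid inequalities, hence the set of points of `COR(H)` satisfying all of them is
indeed a face of `COR(H)`" (p0006 L2–3), along which values "propagate" through wires `x_i = x_j =
x_{ij}` ("note that `x_i ≤ x_{ij}` and `x_j ≤ x_{ij}` are both valid inequalities" — the valid
direction is `x_{ij} ≤ x_i`, p0006 L17–18), and then "by projecting onto the diagonal dotted edges …
the face of `COR(H)` described above projects to `COR(K_{h,h})`" (p0006 L19–20), with the folklore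
facts "If `A` is an affine subspace, then `xc(P ∩ A) ≤ xc(P)`, and if `π` is an affine map, then
`xc(π(P)) ≤ xc(P)`" (p0005 L3).

This file is the GENERIC, gate-agnostic half of that argument over the tree's rendering
`Literature.Combinatorics.Optimization.corPolytopeGraph G ⊆ ℝ^{V × V}` of `COR(G)`
(`CorrelationPolytopeGridMinor.lean`; generators `corVec G b`, `b ∈ {0,1}^V`), in the shape of the
`ValiantsHypothesis` support item `GridCorCliqueFace` ("∃ valid `(cv, δ)`, ∃ linear `π`,
`π '' (corPolytopeGraph (gridGraph t) ∩ {x | ∀ i, cv i ⬝ᵥ x = δ i}) = corPolytopeGraph ⊤`"):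

* `convexHull_inter_eq_of_valid_le` — for a finite `S` and inequalities `c_t · y ≤ δ_t` valid on
  `S`, `conv S ∩ {c_t · x = δ_t ∀ t} = conv {y ∈ S | c_t · y = δ_t ∀ t}` (the affine version of
  `convexHull_inter_eq_of_valid` of `CorrelationPolytopeMinorMonotone.lean`): THE VERTICES OF A FACE
  CUT OUT BY VALID INEQUALITIES ARE THE GENERATORS ON IT;
* `dotProduct_le_of_mem_convexHull`, `corPolytopeGraph_valid_iff` — an inequality is valid on
  `COR(G)` iff it is valid on the `0/1` generators `corVec G b` (so validity is a truth-table check);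
* `corPolytopeGraph_inter_eqs_eq`, `image_corPolytopeGraph_inter_eqs_eq` — the face is the convex
  hull of its tight generators, and its image under a linear `π` is the convex hull of their images;
* ★ `image_corPolytopeGraph_inter_eqs_eq_corPolytopeGraph`, `corPolytopeGraph_validFace_image`,
  `exists_finValidFace_image_eq` — the ASSEMBLY LEMMA: if every tight generator of `COR(G)` is
  mapped by `π` to a generator of `COR(H)` ("descend") and every generator of `COR(H)` is so obtained
  ("lift"), then `π '' (COR(G) ∩ face) = COR(H)` — an image EQUALITY, in exactly the `Fin k`-indexed
  `(∀ i, ∀ x ∈ COR(G), cv i ⬝ᵥ x ≤ δ i) ∧ π '' (…) = COR(H)` shape of `GridCorCliqueFace`; thus that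
  statement reduces to three finite assertions about `0/1` assignments;
* `forall_dotProduct_eq_iff_sum` (+ set form) — under validity, a finite family of tight
  inequalities is ONE tight inequality (their sum): "the" face of a family;
* the WIRE lemmas `corVec_adj_le_diag_left/right` (validity of `x_{uv} ≤ x_u`, `x_{uv} ≤ x_v`),
  `corVec_diag_eq_adj_iff` / `corVec_wire_iff` (tightness `x_u = x_{uv}` iff `b u → b v`; both ends
  tight iff `b u = b v`), their `Pi.single` dot-product forms, and propagation of a tight `b` along
  walks / `Fin`-indexed chains (`bool_const_of_walk_darts`, `bool_const_of_chain`);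
* `dotProduct_eq_sum_of_support_subset` — evaluating a sparsely supported gate functional.

No definition, no named fact; nothing here is specific to grids or to a choice of gadgets.

## References

* [AboulkerEtAl2019] P. Aboulker, S. Fiorini, T. Huynh, M. Macchia, J. Seif, *Extension complexity
  of the correlation polytope*, Oper. Res. Lett. 47 (2019) 47–51 = arXiv:1806.00541; §2: folklore
  facts (p0005 L3), Obs. 5 and proof (p0005 L12–18), proof of Thm. 6 (p0005 L53–58, p0006 L1–20).
* [FioriniEtAl2015] S. Fiorini, S. Massar, S. Pokutta, H. R. Tiwary, R. de Wolf, *Exponential lower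
  bounds for polytopes in combinatorial optimization*, J. ACM 62 (2015) = arXiv:1111.0837, Lemma 9
  (extensions, faces and projections) — the tree's `HasEFOfSize.inter_eqs` / `image_linearMap`.
* [AvisTiwary2015] D. Avis, H. R. Tiwary, *On the extension complexity of combinatorial polytopes*,
  Math. Program. 153 (2015) = arXiv:1302.2340, Props. 1–2, Lemma 5 ("this defines a face").
-/

noncomputable section

namespace Literature.Combinatorics.Optimization

open Finset
open Literature.Barriers.PneNP (HasEFOfSize)

/-! ### Faces of a finitely generated convex set cut out by valid inequalities -/

section General

variable {ι : Type} [Fintype ι]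

/-- **The vertices of a face cut out by valid inequalities are the generators on it.**  For a finite
`S ⊆ ℝ^ι` and a family of inequalities `c_t · y ≤ δ_t` valid on `S`,
`conv(S) ∩ {x | c_t · x = δ_t ∀ t} = conv {y ∈ S | c_t · y = δ_t ∀ t}`: a convex combination lying
on the face puts no weight on generators strictly inside some inequality.  (Affine version of
`convexHull_inter_eq_of_valid`.)  This is the printed "the equations we add originate from valid
inequalities, hence the set of points of `COR(H)` satisfying all of them is indeed a face of `COR(H)`".
[cite: AboulkerEtAl2019, proof of Thm. 6 (arXiv:1806.00541 §2, p0006 L2–3) and proof of Obs. 5 (p0005 L18)] [folklore] -/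
theorem convexHull_inter_eq_of_valid_le (S : Finset (ι → ℝ)) {T : Type} (c : T → ι → ℝ)
    (δ : T → ℝ) (hS : ∀ y ∈ S, ∀ t, c t ⬝ᵥ y ≤ δ t) :
    convexHull ℝ (↑S : Set (ι → ℝ)) ∩ {x | ∀ t, c t ⬝ᵥ x = δ t} =
      convexHull ℝ {y | y ∈ S ∧ ∀ t, c t ⬝ᵥ y = δ t} := by
  classical
  set S' : Finset (ι → ℝ) := S.filter fun y => ∀ t, c t ⬝ᵥ y = δ t with hS'def
  have hS' : {y | y ∈ S ∧ ∀ t, c t ⬝ᵥ y = δ t} = (↑S' : Set (ι → ℝ)) := by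
    ext y; simp [hS'def]
  rw [hS']
  have hsub : S' ⊆ S := Finset.filter_subset _ _
  apply Set.Subset.antisymm
  · rintro x ⟨hx, hxK⟩
    obtain ⟨w, hw0, hw1, hwx⟩ := Finset.mem_convexHull.1 hx
    have key : ∀ y ∈ S, y ∉ S' → w y = 0 := by
      intro y hy hyS'
      have hnot : ¬ ∀ t, c t ⬝ᵥ y = δ t := fun h => hyS' (Finset.mem_filter.2 ⟨hy, h⟩)
      obtain ⟨t, hyt⟩ := not_forall.1 hnot
      have hxt : c t ⬝ᵥ x = ∑ z ∈ S, w z * (c t ⬝ᵥ z) := by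
        rw [← hwx, Finset.centerMass_eq_of_sum_1 _ _ hw1, dotProduct_sum]
        refine Finset.sum_congr rfl fun z _ => ?_
        rw [id, dotProduct_smul, smul_eq_mul]
      have hsum0 : ∑ z ∈ S, w z * (δ t - c t ⬝ᵥ z) = 0 := by
        have hsplit : ∑ z ∈ S, w z * (δ t - c t ⬝ᵥ z) =
            (∑ z ∈ S, w z) * δ t - ∑ z ∈ S, w z * (c t ⬝ᵥ z) := by
          rw [Finset.sum_mul, ← Finset.sum_sub_distrib]
          exact Finset.sum_congr rfl fun z _ => by ring
        rw [hsplit, hw1, one_mul, ← hxt, hxK t, sub_self]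
      have hterm := (Finset.sum_eq_zero_iff_of_nonneg (fun z hz =>
        mul_nonneg (hw0 z hz) (sub_nonneg.2 (hS z hz t)))).1 hsum0 _ hy
      rcases mul_eq_zero.1 hterm with h | h
      · exact h
      · exact absurd (sub_eq_zero.1 h).symm hyt
    refine Finset.mem_convexHull.2 ⟨w, fun y hy => hw0 y (hsub hy), ?_, ?_⟩
    · rw [Finset.sum_subset hsub key]; exact hw1
    · rw [Finset.centerMass_subset _ hsub key]; exact hwx
  · refine Set.subset_inter (convexHull_mono (Finset.coe_subset.2 hsub)) (convexHull_min ?_ ?_)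
    · intro y hy t
      exact (Finset.mem_filter.1 (Finset.mem_coe.1 hy)).2 t
    · intro x hx y hy a b _ _ hab t
      have hx' : c t ⬝ᵥ x = δ t := hx t
      have hy' : c t ⬝ᵥ y = δ t := hy t
      rw [dotProduct_add, dotProduct_smul, dotProduct_smul, hx', hy', smul_eq_mul, smul_eq_mul,
        ← add_mul, hab, one_mul]

/-- **Validity passes to the convex hull**: an inequality valid on `s` is valid on `conv(s)` (half
spaces are convex) — the reduction of "valid on the polytope" to "valid on its generators".
[cite: AboulkerEtAl2019, §2 (p0006 L2–3: "valid inequalities")] [folklore] -/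
theorem dotProduct_le_of_mem_convexHull {s : Set (ι → ℝ)} (c : ι → ℝ) (δ : ℝ)
    (hs : ∀ y ∈ s, c ⬝ᵥ y ≤ δ) {x : ι → ℝ} (hx : x ∈ convexHull ℝ s) : c ⬝ᵥ x ≤ δ := by
  refine (convexHull_min (fun y hy => (hs y hy : y ∈ {z : ι → ℝ | c ⬝ᵥ z ≤ δ})) ?_) hx
  intro x hx y hy a b ha hb hab
  show c ⬝ᵥ (a • x + b • y) ≤ δ
  rw [dotProduct_add, dotProduct_smul, dotProduct_smul, smul_eq_mul, smul_eq_mul]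
  calc a * (c ⬝ᵥ x) + b * (c ⬝ᵥ y) ≤ a * δ + b * δ :=
        add_le_add (mul_le_mul_of_nonneg_left hx ha) (mul_le_mul_of_nonneg_left hy hb)
    _ = δ := by rw [← add_mul, hab, one_mul]

/-- **A valid family tight everywhere is one tight valid inequality (the sum).**  If
`c_t · x ≤ δ_t` for all `t` then `(∀ t, c_t · x = δ_t) ↔ (∑_t c_t) · x = ∑_t δ_t`: the face of a
finite family of valid inequalities is the face of their sum.
[cite: AvisTiwary2015, proof of Thm. 13 (arXiv:1302.2340 p. 13: one tight valid inequality per edge, "equivalently their sum")] [folklore] -/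
theorem forall_dotProduct_eq_iff_sum {T : Type} [Fintype T] (c : T → ι → ℝ) (δ : T → ℝ)
    (x : ι → ℝ) (hle : ∀ t, c t ⬝ᵥ x ≤ δ t) :
    (∀ t, c t ⬝ᵥ x = δ t) ↔ (∑ t, c t) ⬝ᵥ x = ∑ t, δ t := by
  rw [sum_dotProduct]
  constructor
  · intro h
    exact Finset.sum_congr rfl fun t _ => h t
  · intro h t
    have h0 : ∑ s, (δ s - c s ⬝ᵥ x) = 0 := by
      rw [Finset.sum_sub_distrib, h, sub_self]
    have ht := (Finset.sum_eq_zero_iff_of_nonneg fun s _ => sub_nonneg.2 (hle s)).1 h0 t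
      (Finset.mem_univ t)
    exact ((sub_eq_zero.1 ht).symm)

/-- Evaluating a sparsely supported functional: if `c` vanishes off `s` then
`c · x = ∑_{p ∈ s} c_p x_p` (gate functionals touch only the coordinates of one gadget).
[folklore] [cite: AboulkerEtAl2019, proof of Thm. 6 (p0006 L4–13: the gadget equations)] -/
theorem dotProduct_eq_sum_of_support_subset (c x : ι → ℝ) (s : Finset ι)
    (hc : ∀ p ∉ s, c p = 0) : c ⬝ᵥ x = ∑ p ∈ s, c p * x p := by
  unfold dotProduct
  symm
  refine Finset.sum_subset (Finset.subset_univ s) fun p _ hp => ?_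
  rw [hc p hp, zero_mul]

/-- `(e_p − e_q) · x = x_p − x_q` — the dot-product form of a wire / propagation equation.
[cite: AboulkerEtAl2019, proof of Thm. 6 (p0006 L17: "we set x_i = x_j = x_{ij}")] [folklore] -/
theorem single_sub_single_dotProduct [DecidableEq ι] (p q : ι) (x : ι → ℝ) :
    (Pi.single p (1 : ℝ) - Pi.single q 1) ⬝ᵥ x = x p - x q := by
  rw [sub_dotProduct, single_dotProduct, single_dotProduct, one_mul, one_mul]

end General

/-! ### Faces of `COR(G)` and their linear images -/

section Cor

variable {V : Type} [Fintype V] [DecidableEq V] (G : SimpleGraph V) [DecidableRel G.Adj]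

/-- **Validity on `COR(G)` = validity on the `0/1` generators** `corVec G b` (a truth-table check).
[cite: AboulkerEtAl2019, proof of Thm. 6 (p0006 L2–3) with §1 (COR(G) = conv of its 0/1 points, p0003 L3)] -/
theorem corPolytopeGraph_valid_iff (c : V × V → ℝ) (δ : ℝ) :
    (∀ x ∈ corPolytopeGraph G, c ⬝ᵥ x ≤ δ) ↔ ∀ b, c ⬝ᵥ corVec G b ≤ δ := by
  refine ⟨fun h b => h _ (corVec_mem_corPolytopeGraph G b), fun h x hx => ?_⟩
  refine dotProduct_le_of_mem_convexHull c δ ?_ hx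
  rintro y ⟨b, rfl⟩
  exact h b

/-- **Vertex lemma.**  The face of `COR(G)` cut out by a family of inequalities valid on the
generators is the convex hull of the TIGHT generators:
`COR(G) ∩ {x | cv_t · x = δ_t ∀ t} = conv {corVec G b | cv_t · corVec G b = δ_t ∀ t}`.
[cite: AboulkerEtAl2019, proof of Thm. 6 (p0006 L2–3, L14–15: "the above constraints define a face of COR(H)")] -/
theorem corPolytopeGraph_inter_eqs_eq {T : Type} (cv : T → V × V → ℝ) (δ : T → ℝ)
    (hvalid : ∀ t b, cv t ⬝ᵥ corVec G b ≤ δ t) :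
    corPolytopeGraph G ∩ {x | ∀ t, cv t ⬝ᵥ x = δ t} =
      convexHull ℝ (corVec G '' {b | ∀ t, cv t ⬝ᵥ corVec G b = δ t}) := by
  classical
  have hS : Set.range (corVec G) = ↑(Finset.univ.image (corVec G)) := by
    rw [Finset.coe_image, Finset.coe_univ, Set.image_univ]
  have hT : corVec G '' {b | ∀ t, cv t ⬝ᵥ corVec G b = δ t} =
      {y | y ∈ Finset.univ.image (corVec G) ∧ ∀ t, cv t ⬝ᵥ y = δ t} := by
    ext y
    simp only [Set.mem_image, Set.mem_setOf_eq, Finset.mem_image, Finset.mem_univ, true_and]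
    constructor
    · rintro ⟨b, hb, rfl⟩
      exact ⟨⟨b, rfl⟩, hb⟩
    · rintro ⟨⟨b, rfl⟩, hb⟩
      exact ⟨b, hb, rfl⟩
  rw [corPolytopeGraph, hS, hT]
  refine convexHull_inter_eq_of_valid_le _ cv δ fun y hy t => ?_
  obtain ⟨b, _, rfl⟩ := Finset.mem_image.1 hy
  exact hvalid t b

/-- Under validity the family face is the face of ONE valid inequality, the sum (set form of
`forall_dotProduct_eq_iff_sum` on `COR(G)`). [cite: AvisTiwary2015, proof of Thm. 13 (p. 13, "equivalently their sum")] [folklore] -/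
theorem corPolytopeGraph_inter_eqs_eq_inter_sum {T : Type} [Fintype T] (cv : T → V × V → ℝ)
    (δ : T → ℝ) (hvalid : ∀ t b, cv t ⬝ᵥ corVec G b ≤ δ t) :
    corPolytopeGraph G ∩ {x | ∀ t, cv t ⬝ᵥ x = δ t} =
      corPolytopeGraph G ∩ {x | (∑ t, cv t) ⬝ᵥ x = ∑ t, δ t} := by
  ext x
  simp only [Set.mem_inter_iff, Set.mem_setOf_eq]
  constructor
  · rintro ⟨hx, h⟩
    exact ⟨hx, (forall_dotProduct_eq_iff_sum cv δ x fun t =>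
      (corPolytopeGraph_valid_iff G (cv t) (δ t)).2 (hvalid t) x hx).1 h⟩
  · rintro ⟨hx, h⟩
    exact ⟨hx, (forall_dotProduct_eq_iff_sum cv δ x fun t =>
      (corPolytopeGraph_valid_iff G (cv t) (δ t)).2 (hvalid t) x hx).2 h⟩

/-- **The image of the face under a linear map** is the convex hull of the images of the tight
generators (`LinearMap.image_convexHull`): the printed "projecting onto the diagonal dotted edges".
[cite: AboulkerEtAl2019, proof of Thm. 6 (p0006 L19–20) with the folklore fact p0005 L3] -/
theorem image_corPolytopeGraph_inter_eqs_eq {E : Type} [AddCommGroup E] [Module ℝ E]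
    (π : (V × V → ℝ) →ₗ[ℝ] E) {T : Type} (cv : T → V × V → ℝ) (δ : T → ℝ)
    (hvalid : ∀ t b, cv t ⬝ᵥ corVec G b ≤ δ t) :
    π '' (corPolytopeGraph G ∩ {x | ∀ t, cv t ⬝ᵥ x = δ t}) =
      convexHull ℝ ((fun b => π (corVec G b)) '' {b | ∀ t, cv t ⬝ᵥ corVec G b = δ t}) := by
  rw [corPolytopeGraph_inter_eqs_eq G cv δ hvalid, LinearMap.image_convexHull, Set.image_image]

/-- **Assembly lemma ("the face of `COR(G)` described above projects to `COR(H)`").**  Let the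
inequalities `cv_t · x ≤ δ_t` be valid on the generators of `COR(G)` and let `π` be linear.  If every
TIGHT generator `corVec G b` is mapped to a generator of `COR(H)` (*descend*) and every generator of
`COR(H)` arises this way (*lift*), then `π(COR(G) ∩ {cv_t · x = δ_t ∀ t}) = COR(H)` — an EQUALITY of
sets (every point of the face, not only its vertices, lands in `COR(H)`, by the vertex lemma and
linearity). [cite: AboulkerEtAl2019, proof of Thm. 6 (arXiv:1806.00541 p0005 L53–58, p0006 L14–20)] -/
theorem image_corPolytopeGraph_inter_eqs_eq_corPolytopeGraph {W : Type} [DecidableEq W]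
    (H : SimpleGraph W) [DecidableRel H.Adj] (π : (V × V → ℝ) →ₗ[ℝ] (W × W → ℝ))
    {T : Type} (cv : T → V × V → ℝ) (δ : T → ℝ)
    (hvalid : ∀ t b, cv t ⬝ᵥ corVec G b ≤ δ t)
    (hdesc : ∀ b, (∀ t, cv t ⬝ᵥ corVec G b = δ t) → ∃ b', π (corVec G b) = corVec H b')
    (hlift : ∀ b', ∃ b, (∀ t, cv t ⬝ᵥ corVec G b = δ t) ∧ π (corVec G b) = corVec H b') :
    π '' (corPolytopeGraph G ∩ {x | ∀ t, cv t ⬝ᵥ x = δ t}) = corPolytopeGraph H := by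
  rw [image_corPolytopeGraph_inter_eqs_eq G π cv δ hvalid, corPolytopeGraph]
  congr 1
  ext z
  simp only [Set.mem_image, Set.mem_setOf_eq, Set.mem_range]
  constructor
  · rintro ⟨b, hb, rfl⟩
    obtain ⟨b', hb'⟩ := hdesc b hb
    exact ⟨b', hb'.symm⟩
  · rintro ⟨b', rfl⟩
    exact hlift b'

/-- **The two conjuncts of a `GridCorCliqueFace`-type statement from three finite checks.**  With
validity of each `cv_t` on the `0/1` generators, *descend* and *lift* as in the assembly lemma:
`(∀ t, ∀ x ∈ COR(G), cv_t · x ≤ δ_t) ∧ π(COR(G) ∩ {cv_t · x = δ_t ∀ t}) = COR(H)`.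
[cite: AboulkerEtAl2019, proof of Thm. 6 (p0006 L2–3, L14–20)] -/
theorem corPolytopeGraph_validFace_image {W : Type} [DecidableEq W] (H : SimpleGraph W)
    [DecidableRel H.Adj] (π : (V × V → ℝ) →ₗ[ℝ] (W × W → ℝ)) {T : Type} (cv : T → V × V → ℝ)
    (δ : T → ℝ) (hvalid : ∀ t b, cv t ⬝ᵥ corVec G b ≤ δ t)
    (hdesc : ∀ b, (∀ t, cv t ⬝ᵥ corVec G b = δ t) → ∃ b', π (corVec G b) = corVec H b')
    (hlift : ∀ b', ∃ b, (∀ t, cv t ⬝ᵥ corVec G b = δ t) ∧ π (corVec G b) = corVec H b') :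
    (∀ t, ∀ x ∈ corPolytopeGraph G, cv t ⬝ᵥ x ≤ δ t) ∧
      π '' (corPolytopeGraph G ∩ {x | ∀ t, cv t ⬝ᵥ x = δ t}) = corPolytopeGraph H :=
  ⟨fun t => (corPolytopeGraph_valid_iff G (cv t) (δ t)).2 (hvalid t),
    image_corPolytopeGraph_inter_eqs_eq_corPolytopeGraph G H π cv δ hvalid hdesc hlift⟩

/-- **`Fin k`-indexed packaging** (the literal shape of the support item: `∃ (k : ℕ) (cv : Fin k → _)
(δ : Fin k → ℝ) (π : _ →ₗ[ℝ] _), (∀ i, ∀ x ∈ COR(G), cv i ⬝ᵥ x ≤ δ i) ∧ π '' (…) = COR(H)`): a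
construction may index its constraints by any finite type `T`; re-index by `Fintype.equivFin`.
[cite: AboulkerEtAl2019, proof of Thm. 6 (p0006 L2–3, L14–20)] -/
theorem exists_finValidFace_image_eq {W : Type} [DecidableEq W] (H : SimpleGraph W)
    [DecidableRel H.Adj] (π : (V × V → ℝ) →ₗ[ℝ] (W × W → ℝ)) {T : Type} [Fintype T]
    (cv : T → V × V → ℝ) (δ : T → ℝ) (hvalid : ∀ t b, cv t ⬝ᵥ corVec G b ≤ δ t)
    (hdesc : ∀ b, (∀ t, cv t ⬝ᵥ corVec G b = δ t) → ∃ b', π (corVec G b) = corVec H b')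
    (hlift : ∀ b', ∃ b, (∀ t, cv t ⬝ᵥ corVec G b = δ t) ∧ π (corVec G b) = corVec H b') :
    ∃ (k : ℕ) (cv' : Fin k → V × V → ℝ) (δ' : Fin k → ℝ)
      (π' : (V × V → ℝ) →ₗ[ℝ] (W × W → ℝ)),
      (∀ i, ∀ x ∈ corPolytopeGraph G, cv' i ⬝ᵥ x ≤ δ' i) ∧
        π' '' (corPolytopeGraph G ∩ {x | ∀ i, cv' i ⬝ᵥ x = δ' i}) = corPolytopeGraph H := by
  let e := Fintype.equivFin T
  have hset : {x : V × V → ℝ | ∀ i : Fin (Fintype.card T), cv (e.symm i) ⬝ᵥ x = δ (e.symm i)} =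
      {x | ∀ t, cv t ⬝ᵥ x = δ t} := by
    ext x
    simp only [Set.mem_setOf_eq]
    constructor
    · intro h t
      simpa using h (e t)
    · intro h i
      exact h (e.symm i)
  refine ⟨Fintype.card T, fun i => cv (e.symm i), fun i => δ (e.symm i), π, fun i =>
    (corPolytopeGraph_valid_iff G _ _).2 (hvalid (e.symm i)), ?_⟩
  rw [hset]
  exact image_corPolytopeGraph_inter_eqs_eq_corPolytopeGraph G H π cv δ hvalid hdesc hlift

end Cor

/-! ### Wires: `x_{uv} ≤ x_u`, `x_{uv} ≤ x_v` are valid, and tightness propagates values -/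

section Wire

variable {V : Type} [DecidableEq V] {G : SimpleGraph V} [DecidableRel G.Adj]

/-- Validity of `x_{uv} ≤ x_u` on the generators. [cite: AboulkerEtAl2019, proof of Obs. 5 (p0005 L18: "x_{uv} ≤ x_u and x_{uv} ≤ x_v are valid") and of Thm. 6 (p0006 L17–18)] -/
theorem corVec_adj_le_diag_left (b : V → Bool) {u v : V} (h : G.Adj u v) :
    corVec G b (u, v) ≤ corVec G b (u, u) := by
  rw [corVec_apply_diag, corVec_apply_adj G b h]
  cases b u <;> cases b v <;> simp

/-- Validity of `x_{uv} ≤ x_v` on the generators. [cite: AboulkerEtAl2019, proof of Obs. 5 (p0005 L18) and of Thm. 6 (p0006 L17–18)] -/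
theorem corVec_adj_le_diag_right (b : V → Bool) {u v : V} (h : G.Adj u v) :
    corVec G b (u, v) ≤ corVec G b (v, v) := by
  rw [corVec_swap G b u v]
  exact corVec_adj_le_diag_left b h.symm

/-- Tightness of `x_{uv} ≤ x_u` at a generator: `x_u = x_{uv}` iff `b u → b v`.
[cite: AboulkerEtAl2019, proof of Thm. 6 (p0006 L17–19: "the value of x_i propagates")] -/
theorem corVec_diag_eq_adj_iff (b : V → Bool) {u v : V} (h : G.Adj u v) :
    corVec G b (u, u) = corVec G b (u, v) ↔ (b u = true → b v = true) := by
  rw [corVec_apply_diag, corVec_apply_adj G b h]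
  cases b u <;> cases b v <;> simp

/-- **Wire lemma**: both `x_u = x_{uv}` and `x_v = x_{uv}` hold at a generator iff `b u = b v` — the
printed "we set `x_i = x_j = x_{ij}` … this ensures that … the value of `x_i` propagates".
[cite: AboulkerEtAl2019, proof of Thm. 6 (p0006 L17–19)] -/
theorem corVec_wire_iff (b : V → Bool) {u v : V} (h : G.Adj u v) :
    (corVec G b (u, u) = corVec G b (u, v) ∧ corVec G b (v, v) = corVec G b (u, v)) ↔
      b u = b v := by
  rw [corVec_apply_diag, corVec_apply_diag, corVec_apply_adj G b h]
  cases b u <;> cases b v <;> simp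

/-- The wire inequality as a functional: `(e_{(u,v)} − e_{(u,u)}) · x ≤ 0` is valid on the generators,
with value `x_{(u,v)} − x_{(u,u)}`. [cite: AboulkerEtAl2019, proof of Thm. 6 (p0006 L17–18)] -/
theorem wire_dotProduct_corVec_le [Fintype V] (b : V → Bool) {u v : V} (h : G.Adj u v) :
    (Pi.single (u, v) (1 : ℝ) - Pi.single (u, u) 1) ⬝ᵥ corVec G b ≤ 0 := by
  classical
  rw [single_sub_single_dotProduct, sub_nonpos]
  exact corVec_adj_le_diag_left b h

/-- … and it is tight iff `b u → b v`. [cite: AboulkerEtAl2019, proof of Thm. 6 (p0006 L17–19)] -/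
theorem wire_dotProduct_corVec_eq_zero_iff [Fintype V] (b : V → Bool) {u v : V} (h : G.Adj u v) :
    (Pi.single (u, v) (1 : ℝ) - Pi.single (u, u) 1) ⬝ᵥ corVec G b = 0 ↔ (b u = true → b v = true) := by
  classical
  rw [single_sub_single_dotProduct, sub_eq_zero, eq_comm]
  exact corVec_diag_eq_adj_iff b h

end Wire

section Propagation

variable {V : Type} {G : SimpleGraph V}

/-- **Propagation along a walk**: if `b` agrees across every dart of a walk from `u` to `v` (e.g.
because every edge of the walk is a tight wire, `corVec_wire_iff`), then `b u = b v`.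
[cite: AboulkerEtAl2019, proof of Thm. 6 (p0006 L17–19: propagation along vertical / horizontal paths)] -/
theorem bool_const_of_walk_darts (b : V → Bool) :
    ∀ {u v : V} (p : G.Walk u v), (∀ d ∈ p.darts, b d.fst = b d.snd) → b u = b v
  | _, _, SimpleGraph.Walk.nil, _ => rfl
  | _, _, SimpleGraph.Walk.cons hxy p, h =>
      (h ⟨(_, _), hxy⟩ (by simp)).trans
        (bool_const_of_walk_darts b p fun d hd => h d (by simp [hd]))

/-- **Propagation along an indexed chain** (rows and columns of a grid): if `b (f i) = b (f (i+1))`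
for all `i < m` then `b (f i) = b (f 0)` for all `i ≤ m`. [cite: AboulkerEtAl2019, proof of Thm. 6 (p0006 L17–19)] [folklore] -/
theorem bool_const_of_chain (b : V → Bool) {m : ℕ} (f : Fin (m + 1) → V)
    (h : ∀ i : Fin m, b (f i.castSucc) = b (f i.succ)) : ∀ i : Fin (m + 1), b (f i) = b (f 0) := by
  intro i
  induction i using Fin.induction with
  | zero => rfl
  | succ i ih => rw [← h i, ih]

end Propagation

end Literature.Combinatorics.Optimization

end
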